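import Summits.NavierStokesRegularity.NavierStokesRegularity.Theses.CoreLogGas

/-!
# Route CoreLogGas — `Assembly` (item stmt-NavierStokesRegularity-11292)

Pure logic: the route statements of `CoreLogGas`, in the antecedent order

  `LocallyDrivenIsTypeI → BlowupIsLocallyDriven → NoTypeIBlowup → NoBlowupToClay →
   NavierStokesRegularity`,

imply Clay (A). This is, hypothesis for hypothesis, the route's deciding theorem
`Summit.NavierStokesRegularity.NavierStokesRegularity.Theses.CoreLogGas.closes`; the proof below is
self-contained (it does not invoke `closes`), so that it depends only on the item definitions.

Argument. `NoBlowupToClay` reduces `NavierStokesRegularity` to: every finite-energy (Leray–Hopf)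
classical solution on `ℝ³ × [0,T)` from a rapidly decaying datum extends smoothly past `T`. Suppose
one does not. Then it is maximal (`IsMaximalSmoothSolution = classical ∧ ¬ HasSmoothExtensionPast`,
definitional), so `BlowupIsLocallyDriven` (B) supplies the locality hypothesis `H(M, t₀, g)`,
`LocallyDrivenIsTypeI` (A) turns it into the Type-I rate `IsTypeIBlowup u T`, and `NoTypeIBlowup`
(Type-I exclusion for Clay data, shared stmt-NavierStokesRegularity-1217) extends the solution past
`T` — contradiction. Nothing here is new mathematics; the open content lives in the cruxes A, B and
`NoTypeIBlowup`.
-/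

namespace Summit.NavierStokesRegularity.NavierStokesRegularity.Theorems

open Summit.NavierStokesRegularity.NavierStokesRegularity.Theses.CoreLogGas

/-- **Assembly** (item stmt-NavierStokesRegularity-11292, route CoreLogGas):
`LocallyDrivenIsTypeI → BlowupIsLocallyDriven → NoTypeIBlowup → NoBlowupToClay →
NavierStokesRegularity` — pure logic: `NoBlowupToClay` reduces Clay (A) to continuation past every
`T`; a non-extendable solution is maximal, so `BlowupIsLocallyDriven` gives the locality hypothesis,
`LocallyDrivenIsTypeI` the Type-I rate, and `NoTypeIBlowup` a smooth extension past `T`,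
contradicting non-extendability. Mirror of the route's deciding theorem `closes`. [folklore] -/
theorem coreLogGas_assembly_proof :
    Summit.NavierStokesRegularity.NavierStokesRegularity.Theses.CoreLogGas.Assembly := by
  unfold Assembly
  intro hA hB hI hC
  refine hC ?_
  intro ν T hν hT u p hcl hLH hdec
  by_contra hne
  have hmax : Literature.Analysis.FluidPDE.IsMaximalSmoothSolution ν 0 u p T := ⟨hcl, hne⟩
  exact hne (hI ν T hν hT u p hcl hLH hdec
    (hA ν T hν hT u p hmax hLH hdec (hB ν T hν hT u p hmax hLH hdec)))

end Summit.NavierStokesRegularity.NavierStokesRegularity.Theorems
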